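import Mathlib
import Summits.Ventures.HodgeRepro.Tier4.Target
import Summits.Ventures.HodgeRepro.Tier4.Common.TargetBall
import Summits.Ventures.HodgeRepro.Tier4.Common.TargetCalculus
import Summits.Ventures.HodgeRepro.Tier4.Common.AutForms
import Summits.Ventures.HodgeRepro.Tier4.Line3.KMDatumS
import Summits.Ventures.HodgeRepro.Tier4.Line3.KMDatumS
import Summits.Ventures.HodgeRepro.Tier4.Line3.Defs
import Summits.Ventures.HodgeRepro.Tier4.Line3.HeckeEquivarianceLemmas
import Summits.Ventures.HodgeRepro.Tier4.Line3.IntegrableMajorant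

/-!
# Tier4/Line3/ExpansionPointwise — the pointwise orbit expansion of the integrand of `P_T4` (LINE L3, towards L3.2)

Blind re-derivation cell `pub-hodge-repro`, Tier 4 «PROVE THE STEP» (README §9–§10), seat t4-L2-p1 (gen 0), on LINE
L3 (`Tier4/Line3/Skeleton.lean` v0.14, t4-plan-3) by the lead's assignment S12208.  First half of L3.2 `expansion`:
the POINTWISE identity on the ball, for a `ℂ`-combination `γ` of Hecke quadruples,

  `Σ_h a_h · integrand h z = Σ'_{w ∈ LineTuple} summand(γ)(w, z)`  (`sum_integrand_eq_tsum_summand`),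

from L3.1 (`HeckeEquivariant`, displayed as the hypothesis `h1`): the four partial derivatives of the Hecke-translated
corner forms are the theta series of the Hecke-moved coefficient functions (`pd_slot0` … `pd_slot3`), `wedge` is
bilinear against absolutely convergent series (`wedge_tsum`, `tsum_mul_tsum_of_summable_norm`), complex conjugation
passes through a series (`conj_tsum`), the product of the two double series is a series over
`(Line × Line) × (Line × Line) ≃ (Fin 4 → Line)` (`tupleEquiv`), and the absolute convergence of every slot series at
a point of the ball is the majorant of `IntegrableMajorant` on the compact `{z}` (`summable_norm_slotTerm`).
No printed input enters.  Second half (Fubini on the chosen domain, the regrouping by orbits, the theorem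
`T4Data.expansion` verbatim): `Tier4/Line3/Expansion.lean`.
Nothing here says anything about the status of the Hodge conjecture for CM abelian varieties, which is NOT proved
(HC_CM is NOT proved by anyone in this repository).
-/

set_option autoImplicit false

noncomputable section

namespace Summit.Ventures.HodgeRepro.Tier4.Line3

open Summit.Ventures.HodgeRepro.Tier4
open Matrix MeasureTheory
open scoped ComplexConjugate

namespace Expansion

open HeckeEquivariance IntegrableMajorant

/-! ### 1. Bilinearity of `wedge` against absolutely convergent series -/

/-- `wedge` of two `ℂ`-multiples. -/
theorem wedge_mul_mul (c c' : ℂ) (d d' : Fin 2 → ℂ) :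
    wedge (fun k => c * d k) (fun k => c' * d' k) = c * c' * wedge d d' := by
  unfold wedge
  ring

/-- `wedge` of two absolutely convergent series of `ℂ²`-vectors is the double series of the wedges. -/
theorem wedge_tsum {ι κ : Type} (A : ι → Fin 2 → ℂ) (B : κ → Fin 2 → ℂ)
    (hA : ∀ k, Summable (fun i => ‖A i k‖)) (hB : ∀ k, Summable (fun j => ‖B j k‖)) :
    wedge (fun k => ∑' i, A i k) (fun k => ∑' j, B j k) = ∑' p : ι × κ, wedge (A p.1) (B p.2) := by
  unfold wedge
  rw [tsum_mul_tsum_of_summable_norm (hA 0) (hB 1), tsum_mul_tsum_of_summable_norm (hA 1) (hB 0),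
    ← (summable_mul_of_summable_norm (hA 0) (hB 1)).tsum_sub (summable_mul_of_summable_norm (hA 1) (hB 0))]

/-- The norms of the wedges of two absolutely convergent series are summable over the pairs. -/
theorem summable_norm_wedge {ι κ : Type} (A : ι → Fin 2 → ℂ) (B : κ → Fin 2 → ℂ)
    (hA : ∀ k, Summable (fun i => ‖A i k‖)) (hB : ∀ k, Summable (fun j => ‖B j k‖)) :
    Summable (fun p : ι × κ => ‖wedge (A p.1) (B p.2)‖) := by
  have h1 : Summable (fun p : ι × κ => ‖A p.1 0‖ * ‖B p.2 1‖) :=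
    Summable.mul_of_nonneg (f := fun i => ‖A i 0‖) (g := fun j => ‖B j 1‖) (hA 0) (hB 1)
      (fun _ => norm_nonneg _) (fun _ => norm_nonneg _)
  have h2 : Summable (fun p : ι × κ => ‖A p.1 1‖ * ‖B p.2 0‖) :=
    Summable.mul_of_nonneg (f := fun i => ‖A i 1‖) (g := fun j => ‖B j 0‖) (hA 1) (hB 0)
      (fun _ => norm_nonneg _) (fun _ => norm_nonneg _)
  refine Summable.of_nonneg_of_le (fun _ => norm_nonneg _) (fun p => ?_) (h1.add h2)
  unfold wedge
  calc ‖A p.1 0 * B p.2 1 - A p.1 1 * B p.2 0‖ ≤ ‖A p.1 0 * B p.2 1‖ + ‖A p.1 1 * B p.2 0‖ := norm_sub_le _ _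
    _ = ‖A p.1 0‖ * ‖B p.2 1‖ + ‖A p.1 1‖ * ‖B p.2 0‖ := by rw [norm_mul, norm_mul]

/-- Complex conjugation through an absolutely convergent series. -/
theorem conj_tsum {ι : Type} (f : ι → ℂ) : conj (∑' i, f i) = ∑' i, conj (f i) := by
  simpa only [Complex.star_def] using (tsum_star (f := f))

/-- The quadruple index `(Fin 4 → α) ≃ (α × α) × (α × α)`. -/
def tupleEquiv (α : Type) : (Fin 4 → α) ≃ (α × α) × (α × α) where
  toFun w := ((w 0, w 1), (w 2, w 3))
  invFun p := ![p.1.1, p.1.2, p.2.1, p.2.2]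
  left_inv w := by
    funext i
    fin_cases i <;> rfl
  right_inv p := rfl

/-! ### 2. The slot series and their absolute convergence on the ball -/

variable (X : T4Data)

/-- The slot `j` summand of the theta series of the Hecke-moved coefficient function, at the line `o`. -/
def slotTerm (D : X.ThetaData) {K : X.Level} (h : X.TrZ K) (j : Fin 4) (o : X.Line) (z : Fin 2 → ℂ) :
    Fin 2 → ℂ :=
  fun k => X.heckeAct (h.1 (X.slot j)) (D.cf j) (Quot.out o) * datumS D.Φ (X.ballCoord (Quot.out o)) z k

/-- Absolute convergence of the slot series at every point of the ball (the majorant of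
`IntegrableMajorant` on the compact `{z}`). -/
theorem summable_norm_slotTerm (D : X.ThetaData) {K : X.Level} (h : X.TrZ K) (j : Fin 4) {z : Fin 2 → ℂ}
    (hz : z ∈ ball) (k : Fin 2) : Summable (fun o : X.Line => ‖slotTerm X D h j o z k‖) := by
  obtain ⟨g, hgs, hgb⟩ := exists_majorant_heckeAct X D j K (h.2 (X.slot j)) isCompact_singleton
    (Set.singleton_subset_iff.mpr hz) k
  exact Summable.of_nonneg_of_le (fun _ => norm_nonneg _) (fun o => hgb z rfl o) hgs

/-- The theta series of the Hecke-moved coefficient function of slot `j` is the sum of the slot terms. -/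
theorem theta_eq_tsum_slotTerm (D : X.ThetaData) {K : X.Level} (h : X.TrZ K) (j : Fin 4) (z : Fin 2 → ℂ)
    (k : Fin 2) :
    X.theta D.Φ (X.heckeAct (h.1 (X.slot j)) (D.cf j)) z k = ∑' o : X.Line, slotTerm X D h j o z k := rfl

/-- The slot labels: `slot 0 = i₁`. -/
theorem slot_zero : X.slot 0 = X.i₁ := rfl

/-- `slot 1 = i₂`. -/
theorem slot_one : X.slot 1 = X.i₂ := rfl

/-- `slot 2 = i₃`. -/
theorem slot_two : X.slot 2 = X.i₃ := rfl

/-- `slot 3 = i₄`. -/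
theorem slot_three : X.slot 3 = X.i₄ := rfl

/-! ### 3. The four partial derivatives of the Hecke-translated corner forms are the slot series (L3.1) -/

/-- Slot 0: `∂_k (T_{h_{i₁}} a_{i₁})_s = θ(h_{i₁} · cf_0)`. -/
theorem pd_slot0 (D : X.ThetaData) (h1 : X.HeckeEquivariant D.Φ) {K : X.Level} (h : X.TrZ K) {z : Fin 2 → ℂ}
    (hz : z ∈ ball) (k : Fin 2) :
    pd k (comp (X.T X.i₁) X.s X.hs₁ (heckeTranslate X.τ₀ X.C (h.1 X.i₁) (X.a X.i₁))) z =
      ∑' o : X.Line, slotTerm X D h 0 o z k :=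
  h1 X.i₁ X.s X.hs₁ (D.cf 0) D.ident₀ (D.invΓ 0) (D.weight 0) (D.summable 0) K (h.1 X.i₁) (h.2 X.i₁) z hz k

/-- Slot 1. -/
theorem pd_slot1 (D : X.ThetaData) (h1 : X.HeckeEquivariant D.Φ) {K : X.Level} (h : X.TrZ K) {z : Fin 2 → ℂ}
    (hz : z ∈ ball) (k : Fin 2) :
    pd k (comp (X.T X.i₂) X.s X.hs₂ (heckeTranslate X.τ₀ X.C (h.1 X.i₂) (X.a X.i₂))) z =
      ∑' o : X.Line, slotTerm X D h 1 o z k :=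
  h1 X.i₂ X.s X.hs₂ (D.cf 1) D.ident₁ (D.invΓ 1) (D.weight 1) (D.summable 1) K (h.1 X.i₂) (h.2 X.i₂) z hz k

/-- Slot 2. -/
theorem pd_slot2 (D : X.ThetaData) (h1 : X.HeckeEquivariant D.Φ) {K : X.Level} (h : X.TrZ K) {z : Fin 2 → ℂ}
    (hz : z ∈ ball) (k : Fin 2) :
    pd k (comp (X.T X.i₃) (conjEmb X.s) X.hs₃ (heckeTranslate X.τ₀ X.C (h.1 X.i₃) (X.a X.i₃))) z =
      ∑' o : X.Line, slotTerm X D h 2 o z k :=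
  h1 X.i₃ (conjEmb X.s) X.hs₃ (D.cf 2) D.ident₂ (D.invΓ 2) (D.weight 2) (D.summable 2) K (h.1 X.i₃) (h.2 X.i₃)
    z hz k

/-- Slot 3. -/
theorem pd_slot3 (D : X.ThetaData) (h1 : X.HeckeEquivariant D.Φ) {K : X.Level} (h : X.TrZ K) {z : Fin 2 → ℂ}
    (hz : z ∈ ball) (k : Fin 2) :
    pd k (comp (X.T X.i₄) (conjEmb X.s) X.hs₄ (heckeTranslate X.τ₀ X.C (h.1 X.i₄) (X.a X.i₄))) z =
      ∑' o : X.Line, slotTerm X D h 3 o z k :=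
  h1 X.i₄ (conjEmb X.s) X.hs₄ (D.cf 3) D.ident₃ (D.invΓ 3) (D.weight 3) (D.summable 3) K (h.1 (X.i₄)) (h.2 X.i₄)
    z hz k

/-! ### 4. The pointwise orbit expansion of the integrand: `Σ_h a_h · integrand h z = Σ_w summand w z` on the ball -/

/-- The quadruple term at the line tuple `w`: `(slot 0 ∧ slot 1) · conj (slot 2 ∧ slot 3)`. -/
def quadTerm (D : X.ThetaData) {K : X.Level} (h : X.TrZ K) (w : X.LineTuple) (z : Fin 2 → ℂ) : ℂ :=
  wedge (slotTerm X D h 0 (w 0) z) (slotTerm X D h 1 (w 1) z) *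
    conj (wedge (slotTerm X D h 2 (w 2) z) (slotTerm X D h 3 (w 3) z))

/-- The quadruple terms are absolutely summable over the line tuples, at every point of the ball. -/
theorem summable_norm_quadTerm (D : X.ThetaData) {K : X.Level} (h : X.TrZ K) {z : Fin 2 → ℂ} (hz : z ∈ ball) :
    Summable (fun w : X.LineTuple => ‖quadTerm X D h w z‖) := by
  have h01 := summable_norm_wedge (fun o => slotTerm X D h 0 o z) (fun o => slotTerm X D h 1 o z)
    (summable_norm_slotTerm X D h 0 hz) (summable_norm_slotTerm X D h 1 hz)
  have h23 := summable_norm_wedge (fun o => slotTerm X D h 2 o z) (fun o => slotTerm X D h 3 o z)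
    (summable_norm_slotTerm X D h 2 hz) (summable_norm_slotTerm X D h 3 hz)
  have hF : Summable (fun q : (X.Line × X.Line) × (X.Line × X.Line) =>
      ‖wedge (slotTerm X D h 0 q.1.1 z) (slotTerm X D h 1 q.1.2 z)‖ *
        ‖wedge (slotTerm X D h 2 q.2.1 z) (slotTerm X D h 3 q.2.2 z)‖) :=
    Summable.mul_of_nonneg (f := fun p : X.Line × X.Line => ‖wedge (slotTerm X D h 0 p.1 z) (slotTerm X D h 1 p.2 z)‖)
      (g := fun p : X.Line × X.Line => ‖wedge (slotTerm X D h 2 p.1 z) (slotTerm X D h 3 p.2 z)‖) h01 h23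
      (fun _ => norm_nonneg _) (fun _ => norm_nonneg _)
  have hF' : Summable (fun q : (X.Line × X.Line) × (X.Line × X.Line) =>
      ‖wedge (slotTerm X D h 0 q.1.1 z) (slotTerm X D h 1 q.1.2 z) *
        conj (wedge (slotTerm X D h 2 q.2.1 z) (slotTerm X D h 3 q.2.2 z))‖) := by
    refine hF.congr fun q => ?_
    rw [norm_mul, Complex.norm_conj]
  exact (tupleEquiv X.Line).summable_iff.mpr hF'

/-- **The integrand of `P_T4` at a Hecke quadruple is the quadruple series** (L3.1 for the four slots, `wedge`
bilinear against the absolutely convergent theta series, the product of two absolutely convergent double series,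
and the reindexing `(Fin 4 → Line) ≃ (Line × Line) × (Line × Line)`). -/
theorem integrand_eq_tsum_quadTerm (D : X.ThetaData) (h1 : X.HeckeEquivariant D.Φ) {K : X.Level} (h : X.TrZ K)
    {z : Fin 2 → ℂ} (hz : z ∈ ball) :
    X.integrand h.1 z = ∑' w : X.LineTuple, quadTerm X D h w z := by
  have e0 : (fun k => pd k (comp (X.T X.i₁) X.s X.hs₁ (heckeTranslate X.τ₀ X.C (h.1 X.i₁) (X.a X.i₁))) z) =
      fun k => ∑' o : X.Line, slotTerm X D h 0 o z k := funext fun k => pd_slot0 X D h1 h hz k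
  have e1 : (fun k => pd k (comp (X.T X.i₂) X.s X.hs₂ (heckeTranslate X.τ₀ X.C (h.1 X.i₂) (X.a X.i₂))) z) =
      fun k => ∑' o : X.Line, slotTerm X D h 1 o z k := funext fun k => pd_slot1 X D h1 h hz k
  have e2 : (fun k => pd k (comp (X.T X.i₃) (conjEmb X.s) X.hs₃
      (heckeTranslate X.τ₀ X.C (h.1 X.i₃) (X.a X.i₃))) z) =
      fun k => ∑' o : X.Line, slotTerm X D h 2 o z k := funext fun k => pd_slot2 X D h1 h hz k
  have e3 : (fun k => pd k (comp (X.T X.i₄) (conjEmb X.s) X.hs₄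
      (heckeTranslate X.τ₀ X.C (h.1 X.i₄) (X.a X.i₄))) z) =
      fun k => ∑' o : X.Line, slotTerm X D h 3 o z k := funext fun k => pd_slot3 X D h1 h hz k
  have h01 := summable_norm_wedge (fun o => slotTerm X D h 0 o z) (fun o => slotTerm X D h 1 o z)
    (summable_norm_slotTerm X D h 0 hz) (summable_norm_slotTerm X D h 1 hz)
  have h23 := summable_norm_wedge (fun o => slotTerm X D h 2 o z) (fun o => slotTerm X D h 3 o z)
    (summable_norm_slotTerm X D h 2 hz) (summable_norm_slotTerm X D h 3 hz)
  have h23' : Summable (fun p : X.Line × X.Line =>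
      ‖conj (wedge (slotTerm X D h 2 p.1 z) (slotTerm X D h 3 p.2 z))‖) := by
    refine h23.congr fun p => ?_
    rw [Complex.norm_conj]
  unfold T4Data.integrand jacDet
  rw [e0, e1, e2, e3,
    wedge_tsum _ _ (summable_norm_slotTerm X D h 0 hz) (summable_norm_slotTerm X D h 1 hz),
    wedge_tsum _ _ (summable_norm_slotTerm X D h 2 hz) (summable_norm_slotTerm X D h 3 hz),
    conj_tsum, tsum_mul_tsum_of_summable_norm h01 h23', ← (tupleEquiv X.Line).tsum_eq]
  rfl

/-- **The pointwise expansion for a `ℂ`-combination of Hecke quadruples**: on the ball,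
`Σ_h a_h · integrand h z = Σ_w summand(γ)(w, z)`. -/
theorem sum_integrand_eq_tsum_summand (D : X.ThetaData) (h1 : X.HeckeEquivariant D.Φ) {K : X.Level} (γ : X.Tr K)
    {z : Fin 2 → ℂ} (hz : z ∈ ball) :
    (Finsupp.sum γ fun h a => a * X.integrand h.1 z) = ∑' w : X.LineTuple, X.summand D.Φ D.cf γ w z := by
  let γ' : X.TrZ K →₀ ℂ := γ
  have hQ : ∀ h : X.TrZ K, Summable (fun w : X.LineTuple => γ' h * quadTerm X D h w z) :=
    fun h => ((summable_norm_quadTerm X D h hz).of_norm).mul_left _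
  calc (Finsupp.sum γ fun h a => a * X.integrand h.1 z)
      = ∑ h ∈ γ'.support, ∑' w : X.LineTuple, γ' h * quadTerm X D h w z := by
        show ∑ h ∈ γ'.support, γ' h * X.integrand h.1 z = _
        refine Finset.sum_congr rfl fun h _ => ?_
        rw [integrand_eq_tsum_quadTerm X D h1 h hz, tsum_mul_left]
    _ = ∑' w : X.LineTuple, ∑ h ∈ γ'.support, γ' h * quadTerm X D h w z :=
        (Summable.tsum_finsetSum fun h _ => hQ h).symm
    _ = ∑' w : X.LineTuple, X.summand D.Φ D.cf γ w z := by
        refine tsum_congr fun w => ?_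
        unfold T4Data.summand T4Data.coefQ T4Data.kernel T4Data.rep quadTerm slotTerm
        rw [Finsupp.sum, Finset.sum_mul]
        refine Finset.sum_congr rfl fun h _ => ?_
        rw [wedge_mul_mul, wedge_mul_mul, map_mul, map_mul]
        ring

end Expansion

end Summit.Ventures.HodgeRepro.Tier4.Line3

end
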